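import Mathlib
import Summits.SmoothPoincare4.SmoothPoincare4.Theorems.SullivanDualTameOrBrodyR4CoreAChartVorticity
import Summits.SmoothPoincare4.SmoothPoincare4.Theorems.SullivanDualTameOrBrodyR4HelperKernelZeroFree

/-!
# CORE-A of crux `TameOrBrodyR4` (stmt-SmoothPoincare4-7826), line `Sketch`: the family of pencil
# members through a member is nowhere tangent at the centre
(stub `helper_nowhereTangentCentre`, FAMc; lead c6, CORE-A wave 4)

The family of pencil members through `u₀` produced by the chart `𝒞` and the order-`0` implicit
function `γ` of its vorticity map `𝒢` (`…CoreAChartVorticity.lean`) is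
`Φ(b') ξ = u₀ ξ + Ψ ξ ((0, b' - b₀) + T(χ₁ γ(b' - b₀)) ξ)`.
It is NOWHERE TANGENT AT THE CENTRE: if `∂_{b'} Φ(b₀) β = ∂_ξ u₀(ξ) ζ` at some point `ξ`, then
`β = 0`.

* differentiating `𝒢(β, γ β) = 0` at `β = 0` with the full derivative
  `CoreA.VorticityData.hasFDerivAt_G_zero` shows that `(β, h')`, `h' = Dγ(0) β`, lies in the
  kernel of the full linearisation `Lfull` (`CoreA.ChartData.Lfull_implicit`);
* read pointwise (`CoreA.ChartData.Lfull_apply_apply`) this is the kernel identity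
  `h' + χ • S₁ ((0, β) + T(χ₁ h')) = 0` of `helper_kernelZeroFree`, whence, for `β ≠ 0`, the
  second component of `η = (0, β) + T(χ₁ h')` has no zeros;
* the `b'`-derivative of the family at `b₀` in direction `β` is `Ψ ξ (η ξ)`
  (`CoreA.ChartData.hasFDerivAt_family_centre`), while `∂_ξ u₀ ζ = Ψ ξ (ζ, 0)` (`𝒞.hΨt`) and
  `Ψ ξ` is injective (`𝒞.hleft`): tangency forces `(η ξ).2 = 0`, so `β = 0`.

* `helper_nowhereTangentCentre` — the registered stub.
-/

-- the registered namespace `Summit.SmoothPoincare4.SmoothPoincare4.…` repeats a component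
set_option linter.dupNamespace false

noncomputable section

open scoped ContDiff Topology NNReal
open Filter Set Metric Literature.Analysis.Complex Literature.Analysis.FunctionSpaces
  Literature.Geometry.Symplectic

namespace Summit.SmoothPoincare4.SmoothPoincare4.Cruxes.TameOrBrodyR4.Sketch

/-- Local notation for the model space `ℝ⁴ = EuclideanSpace ℝ (Fin 4)`. -/
local notation "E4" => EuclideanSpace ℝ (Fin 4)
/-- Local notation for the complex model plane `ℂ²`. -/
local notation "F2" => ℂ × ℂ

namespace CoreA

namespace ChartData

variable {J : E4 → E4 →L[ℝ] E4} {R : ℝ} {P Q : E4 →L[ℝ] ℂ} {eP eQ : ℂ →L[ℝ] E4} {b₀ : ℂ}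
  {u₀ : ℂ → E4} (𝒞 : ChartData J R P Q eP eQ b₀ u₀)
  {r : ℝ≥0} (hr0 : 0 < r) (hr1 : r < 1) (hJs : ContDiff ℝ ∞ J) (hu₀s : ContDiff ℝ ∞ u₀) {k : ℕ}

/-- **The full linearisation of the vorticity map of a chart, pointwise**:
`Lfull (β, h) x = h x + χ x • S₁fun x ((0, β) + T(χ₁ h) x)`. -/
theorem Lfull_apply_apply (β : ℂ) (h : ContDiffHolderFunction ℂ F2 k r) (x : ℂ) :
    (𝒞.vorticity hr0 hr1 hJs hu₀s k).Lfull hr1.le (β, h) x =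
      h x + 𝒞.χ x • 𝒞.S₁fun x
        (((0 : ℂ), β) + cauchyTransformAlong (1 : ℂ) (fun w => 𝒞.χ₁ w • h w) x) := by
  simp only [VorticityData.Lfull_apply, ContDiffHolderFunction.coe_add, Pi.add_apply,
    ContDiffHolderFunction.coeffCLM_apply, vorticity_χ, app_apply, S₁_apply, VorticityData.V₀,
    ContinuousLinearMap.comp_apply, ContDiffHolderFunction.inclCLM_apply, coe_W]

/-- **Differentiating the implicit equation.** If `γ` is differentiable at `0`, `γ 0 = 0` and
`𝒢(β, γ β) = 0` near `β = 0`, then `Lfull (β, Dγ(0) β) = 0` for every `β`: the map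
`β ↦ 𝒢(β, γ β)` has derivative `0` (it vanishes near `0`) and `Lfull ∘ (id, Dγ(0))` (chain rule
with `VorticityData.hasFDerivAt_G_zero`). -/
theorem Lfull_implicit {γ : ℂ → ContDiffHolderFunction ℂ F2 k r} (hγd : DifferentiableAt ℝ γ 0)
    (hγ0 : γ 0 = 0)
    (hγz : ∀ᶠ β in 𝓝 (0 : ℂ), (𝒞.vorticity hr0 hr1 hJs hu₀s k).G hr1.le (β, γ β) = 0)
    (β : ℂ) : (𝒞.vorticity hr0 hr1 hJs hu₀s k).Lfull hr1.le (β, fderiv ℝ γ 0 β) = 0 := by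
  -- `F β' = 𝒢(β', γ β')` vanishes near `0`, so `DF(0) = 0` ...
  have hF0 : HasFDerivAt (fun β' : ℂ => (𝒞.vorticity hr0 hr1 hJs hu₀s k).G hr1.le (β', γ β'))
      (0 : ℂ →L[ℝ] ContDiffHolderFunction ℂ F2 k r) 0 := by
    refine (hasFDerivAt_const (0 : ContDiffHolderFunction ℂ F2 k r) (0 : ℂ)).congr_of_eventuallyEq
      ?_
    filter_upwards [hγz] with β' hβ'
    exact hβ'
  -- ... and by the chain rule `DF(0) = Lfull ∘ (id, Dγ(0))`
  have hG := (𝒞.vorticity hr0 hr1 hJs hu₀s k).hasFDerivAt_G_zero hr1.le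
  have h00 : ((0 : ℂ), γ 0) = ((0 : ℂ), (0 : ContDiffHolderFunction ℂ F2 k r)) := by rw [hγ0]
  rw [← h00] at hG
  have hF1 : HasFDerivAt (fun β' : ℂ => (𝒞.vorticity hr0 hr1 hJs hu₀s k).G hr1.le (β', γ β'))
      (((𝒞.vorticity hr0 hr1 hJs hu₀s k).Lfull hr1.le).comp
        ((ContinuousLinearMap.id ℝ ℂ).prod (fderiv ℝ γ 0))) 0 :=
    HasFDerivAt.comp (f := fun β' : ℂ => (β', γ β')) (0 : ℂ) hG
      ((hasFDerivAt_id (𝕜 := ℝ) (0 : ℂ)).prodMk hγd.hasFDerivAt)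
  have h := congrArg (fun L : ℂ →L[ℝ] ContDiffHolderFunction ℂ F2 k r => L β) (hF1.unique hF0)
  simpa only [ContinuousLinearMap.comp_apply, ContinuousLinearMap.prod_apply,
    ContinuousLinearMap.id_apply, zero_apply] using h

/-- **The `b'`-derivative of the family at the centre.** With `W(β, g) = (0, β) + T(χ₁ g)` (the
linear map `VorticityData.W` of the vorticity data), the family
`b' ↦ u₀ ξ + Ψ ξ (W(b' - b₀, γ(b' - b₀)) ξ)` has derivative `β ↦ Ψ ξ (W(β, Dγ(0) β) ξ)` at `b₀`
whenever `γ` is differentiable at `0`. -/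
theorem hasFDerivAt_family_centre {γ : ℂ → ContDiffHolderFunction ℂ F2 k r}
    (hγd : DifferentiableAt ℝ γ 0) (ξ : ℂ) :
    HasFDerivAt (fun b' : ℂ => u₀ ξ + 𝒞.Ψ ξ (((0 : ℂ), b' - b₀) +
        cauchyTransformAlong (1 : ℂ) (fun w => 𝒞.χ₁ w • γ (b' - b₀) w) ξ))
      (((𝒞.Ψ ξ).comp ((ContDiffHolderFunction.evalCLM ξ).comp
        (𝒞.vorticity hr0 hr1 hJs hu₀s k).W)).comp
          ((ContinuousLinearMap.id ℝ ℂ).prod (fderiv ℝ γ 0))) b₀ := by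
  -- the inner map `b' ↦ (b' - b₀, γ (b' - b₀))` has derivative `(id, Dγ(0))` at `b₀`
  have hγd' : HasFDerivAt γ (fderiv ℝ γ 0) (b₀ - b₀) := by
    rw [sub_self]
    exact hγd.hasFDerivAt
  have h1 := hasFDerivAt_sub_const (𝕜 := ℝ) (x := b₀) b₀
  have h2 : HasFDerivAt (fun b' : ℂ => γ (b' - b₀))
      ((fderiv ℝ γ 0).comp (ContinuousLinearMap.id ℝ ℂ)) b₀ :=
    HasFDerivAt.comp (f := fun b' : ℂ => b' - b₀) b₀ hγd' h1
  have hin : HasFDerivAt (fun b' : ℂ => (b' - b₀, γ (b' - b₀)))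
      ((ContinuousLinearMap.id ℝ ℂ).prod (fderiv ℝ γ 0)) b₀ :=
    (h1.prodMk h2).congr_fderiv (by rw [ContinuousLinearMap.comp_id])
  -- the outer map is `constant + continuous linear`
  have htot := ((((𝒞.Ψ ξ).comp ((ContDiffHolderFunction.evalCLM ξ).comp
    (𝒞.vorticity hr0 hr1 hJs hu₀s k).W)).hasFDerivAt.comp b₀ hin).const_add (u₀ ξ))
  have hfun : (fun b' : ℂ => u₀ ξ + 𝒞.Ψ ξ (((0 : ℂ), b' - b₀) +
      cauchyTransformAlong (1 : ℂ) (fun w => 𝒞.χ₁ w • γ (b' - b₀) w) ξ)) =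
      fun b' : ℂ => u₀ ξ + (((𝒞.Ψ ξ).comp ((ContDiffHolderFunction.evalCLM ξ).comp
        (𝒞.vorticity hr0 hr1 hJs hu₀s k).W)) ∘ fun b' : ℂ => (b' - b₀, γ (b' - b₀))) b' := by
    funext b'
    rfl
  rw [hfun]
  exact htot

end ChartData

end CoreA

/-- **Registered helper `helper_nowhereTangentCentre` (FAMc).** The family of pencil members
`b' ↦ (ξ ↦ u₀ ξ + Ψ ξ ((0, b' - b₀) + T(χ₁ γ(b' - b₀)) ξ))` produced by the order-`0` implicit
function `γ` of the vorticity map of a chart at the member `u₀` is nowhere tangent at the centre: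
if its `b'`-derivative at `b₀` in direction `β` equals a `ξ`-derivative `∂_ξ u₀(ξ) ζ` of the
centre member at some point `ξ`, then `β = 0`. Proof: `(β, Dγ(0) β)` is in the kernel of the full
linearisation (`CoreA.ChartData.Lfull_implicit`), so by `helper_kernelZeroFree` the second
component of `η = (0, β) + T(χ₁ Dγ(0) β)` has no zeros when `β ≠ 0`; but the `b'`-derivative is
`Ψ ξ (η ξ)` (`CoreA.ChartData.hasFDerivAt_family_centre`), `∂_ξ u₀ ζ = Ψ ξ (ζ, 0)` and `Ψ ξ` is
injective, so tangency gives `(η ξ).2 = 0`. -/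
theorem helper_nowhereTangentCentre (J : E4 → E4 →L[ℝ] E4) (R : ℝ) (P Q : E4 →L[ℝ] ℂ)
    (eP eQ : ℂ →L[ℝ] E4) (hR : 0 < R) (hJs : ContDiff ℝ ∞ J) (hJ2 : ∀ x v, J x (J x v) = -v)
    (hPQ : IsCoordFrame P Q eP eQ)
    (hJP : ∀ x : E4, R ≤ ‖x‖ → ∀ v, P (J x v) = Complex.I * P v)
    (hJQ : ∀ x : E4, R ≤ ‖x‖ → ∀ v, Q (J x v) = Complex.I * Q v)
    {r : ℝ≥0} (hr0 : 0 < r) (hr1 : r < 1)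
    (b₀ : ℂ) (u₀ : ℂ → E4) (hu₀ : IsPencilMember J R P Q b₀ u₀)
    (𝒞 : CoreA.ChartData J R P Q eP eQ b₀ u₀) (ε₀ : ℝ) (hε₀ : 0 < ε₀)
    (γ : ℂ → ContDiffHolderFunction ℂ (ℂ × ℂ) 0 r) (hγs : ContDiffOn ℝ ∞ γ (ball 0 ε₀))
    (hγ0 : γ 0 = 0)
    (hγz : ∀ β ∈ ball (0 : ℂ) ε₀, (𝒞.vorticity hr0 hr1 hJs hu₀.1 0).G hr1.le (β, γ β) = 0) :
    ∀ ξ β ζ : ℂ, fderiv ℝ (fun b' : ℂ => u₀ ξ + 𝒞.Ψ ξ (((0 : ℂ), b' - b₀) +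
        cauchyTransformAlong (1 : ℂ) (fun w => 𝒞.χ₁ w • γ (b' - b₀) w) ξ)) b₀ β =
      fderiv ℝ u₀ ξ ζ → β = 0 := by
  intro ξ β ζ hβζ
  by_contra hβ
  -- the structural data of the chart (as in `CoreA.ChartData.L_injective`)
  obtain ⟨hSs, htri, hS0⟩ := 𝒞.S_props hR hJs hJ2 hPQ hJP hJQ hu₀.1 hu₀.2.1
  obtain ⟨M, hM⟩ := 𝒞.S_bound hSs hS0
  have hSχ : ∀ x, 𝒞.χ x ≠ 1 → 𝒞.S x = 0 := by
    intro x hx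
    apply hS0
    by_contra hlt
    exact hx (𝒞.hχ_one x (le_of_lt (not_le.mp hlt)))
  -- `γ` is differentiable at `0`, and `(β, h')`, `h' = Dγ(0) β`, lies in the kernel of `Lfull`
  have hγd : DifferentiableAt ℝ γ 0 :=
    (hγs.differentiableOn (by simp)).differentiableAt (isOpen_ball.mem_nhds (mem_ball_self hε₀))
  have hγz' : ∀ᶠ β' in 𝓝 (0 : ℂ), (𝒞.vorticity hr0 hr1 hJs hu₀.1 0).G hr1.le (β', γ β') = 0 := by
    filter_upwards [isOpen_ball.mem_nhds (mem_ball_self hε₀)] with β' hβ'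
    exact hγz β' hβ'
  have hker : ∀ x, fderiv ℝ γ 0 β x + 𝒞.χ x • 𝒞.S₁fun x (((0 : ℂ), β) +
      cauchyTransformAlong (1 : ℂ) (fun w => 𝒞.χ₁ w • fderiv ℝ γ 0 β w) x) = 0 := by
    intro x
    rw [← 𝒞.Lfull_apply_apply hr0 hr1 hJs hu₀.1, 𝒞.Lfull_implicit hr0 hr1 hJs hu₀.1 hγd hγ0 hγz']
    rfl
  -- the kernel theorem: the second component of `η = (0, β) + T(χ₁ h')` has no zeros
  have hne := helper_kernelZeroFree hr0 hr1 (cauchyTransformHolderApriori_of_lt_one (ℂ × ℂ) hr0 hr1)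
    𝒞.S (𝒞.ρ₁ + 1) M hSs hS0 hM htri 𝒞.χ 𝒞.χ₁ 𝒞.hχ 𝒞.hχ₁ (𝒞.ρ₁ + 3) 𝒞.hρT 𝒞.hχ₁_zero hSχ
    (fun x hx => 𝒞.χ₁_eq_one_of_χ_ne_zero hx) 𝒞.S₁fun (𝒞.contDiff_S₁fun hJs hu₀.1)
    (fun x hx => 𝒞.S₁fun_eq_half_S hx) β hβ (fderiv ℝ γ 0 β) hker ξ
  -- the `b'`-derivative at the centre is `Ψ ξ (η ξ)`, the `ξ`-derivative of `u₀` is `Ψ ξ (ζ, 0)`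
  have hF := 𝒞.hasFDerivAt_family_centre hr0 hr1 hJs hu₀.1 hγd ξ
  have hβζ' : (((𝒞.Ψ ξ).comp ((ContDiffHolderFunction.evalCLM ξ).comp
      (𝒞.vorticity hr0 hr1 hJs hu₀.1 0).W)).comp
        ((ContinuousLinearMap.id ℝ ℂ).prod (fderiv ℝ γ 0))) β = 𝒞.Ψ ξ (ζ, 0) := by
    rw [← hF.fderiv, 𝒞.hΨt ξ ζ]
    exact hβζ
  simp only [ContinuousLinearMap.comp_apply, ContinuousLinearMap.prod_apply,
    ContinuousLinearMap.id_apply, ContDiffHolderFunction.evalCLM_apply] at hβζ'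
  -- `Ψ ξ` is injective, so `η ξ = (ζ, 0)`, contradicting `(η ξ).2 ≠ 0`
  have hinj : Function.Injective (𝒞.Ψ ξ) :=
    Function.LeftInverse.injective (g := 𝒞.Ψinv ξ) fun y => DFunLike.congr_fun (𝒞.hleft ξ) y
  have hη : ((𝒞.vorticity hr0 hr1 hJs hu₀.1 0).W (β, fderiv ℝ γ 0 β) ξ).2 = 0 := by
    rw [hinj hβζ']
  exact hne hη

end Summit.SmoothPoincare4.SmoothPoincare4.Cruxes.TameOrBrodyR4.Sketch
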